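import Mathlib
import HarnessLib
import Summits.MatrixMultiplication.MatrixMultiplication.Theses.OutsiderSandwich
import Summits.MatrixMultiplication.MatrixMultiplication.Theorems.OutsiderSandwichLaserClass

/-!
# OutsiderSandwich — the LASER CLASS is decided, II: rates and attainment
(decomp-mm lens 4 «minimal counterexample / extremal reduction», gen 12; companion of
`OutsiderSandwichLaserClass.lean`, which proves the capacity `B·m^ω ≤ (N+1)³·3^N·2^{((ω−2)/3)N}` of
every packing `⟨B⟩ ⊗ ⟨m,m,m⟩` through a laser datum of extent `N`)

* §5 RATES.  `eventually_poly_le`: `(N+1)^d ≤ 2^{ηN}` eventually.  `laserClassMergeOptimal` — the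
  route item `LaserClassMergeOptimal`: for `N ≥ N₀(ε)` every single product `⟨m,m,m⟩ ≤ D` through a
  laser datum `D` of extent `N` has `m² ≤ 2^{(ℓ(ω)+ε)N}`, `ℓ(ω) = 2/3 + (2/ω)(log₂3 − 2/3)` —
  LITERALLY the conclusion of the residual BOTTOM (`LaserMergeOptimal`, 27897), proved for every
  extraction `cw₂^{⊠N} ⊵ D ⊵ ⟨m,m,m⟩` that factors through the class (capacity at a top point with
  `B = 1`, `(2/ω)`-th power).  `laserClassTangencyForcesOmega` — the route item
  `LaserClassTangencyForcesOmega`: an `LT(s)` datum (cap `b < b_L = log₂3 − 2/3`, packings with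
  `B^s·m² ≥ 3^{sN}·2^{((2/3)(1−s)−ε)N}` cofinally) realised THROUGH laser data forces `ω ≤ 2/s`
  (capacity + cap: `(s − 2/ω)·Γ·N ≤ εN + 3·log(N+1)`, `Γ = log 3 − (2/3 + b)·log 2 > 0`); so at the
  true `ω` no laser datum carries `LT(s)` for `s > 2/ω`, and LT|laser ⟹ `ω = 2` (cf. g10
  `omega_le_of_laserTangencyAt`, which needed BOTTOM as a hypothesis: inside the class BOTTOM is free).
* §6 ATTAINMENT.  `⟨q⟩ ⊗ ⟨a,b,c⟩` is a relabelling of the direct sum of `q` copies of `⟨a,b,c⟩`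
  (`unit_kronecker_matMul_eq`), and Coppersmith–Winograd's zeroing-out of `cw₂^{⊠3k}` (tree
  `laserBlocks`, BCS Thm. 15.41) with `min(p_k, C(3k,k))` blocks of the single type `(k,k,k)` IS a
  laser datum: `laserClassAttained` — the route item `LaserClassAttained` — gives, cofinally in `N`,
  `cw₂^{⊠N} ⊵ D ⊵ ⟨B⟩ ⊗ ⟨m,m,m⟩` with `m = 2^{N/3}`, `B·m² ≥ 3^{(1−ε)N}`; hence the capacity bound is
  tight up to `2^{−εN}` at every exponent and `PerfectAtLaser` (31794) factors through the class.

Sources: CoppersmithWinograd1990 (§§6–7); BurgisserClausenShokrollahi1997 (Thm. 15.41, §15.8);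
Strassen1988; ChristandlVranaZuiddam2023; Blaser2013 (Thm. 5.2, §7); AmbainisFilmusLeGall2015;
AlmanVassilevskaWilliams2018.
-/

set_option linter.dupNamespace false

namespace Summit.MatrixMultiplication.MatrixMultiplication.Theorems.OutsiderSandwichLaserClassRates

open scoped BigOperators
open Finset Filter
open Literature.Computability.AlgebraicComplexity
open Summit.MatrixMultiplication.MatrixMultiplication.Theorems.OutsiderSandwichLaserFloorTop
  (exists_top_point)
open Summit.MatrixMultiplication.MatrixMultiplication.Theorems.OutsiderSandwichLaserMerge (laserBlocks)
open Summit.MatrixMultiplication.MatrixMultiplication.Theorems.OutsiderSandwichLaserClass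
  (laserClassCapacity laserClassCapacity_point_one)

/-! ## 5. Rates: merge-optimality on the laser class, and no cheap tangency -/

/-- Polynomial factors are sub-exponential: `(N+1)^d ≤ 2^{η N}` for `N ≥ N₀(d, η)`. -/
theorem eventually_poly_le (d : ℕ) {η : ℝ} (hη : 0 < η) :
    ∃ N₀ : ℕ, ∀ N : ℕ, N₀ ≤ N → ((N : ℝ) + 1) ^ d ≤ (2 : ℝ) ^ (η * N) := by
  obtain ⟨r, hr_def⟩ : ∃ r : ℝ, r = (2 : ℝ) ^ η := ⟨_, rfl⟩
  have hr : 1 < r := hr_def ▸ Real.one_lt_rpow one_lt_two hη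
  have hr0 : 0 < r := zero_lt_one.trans hr
  have ht := (tendsto_pow_const_div_const_pow_of_one_lt d hr).comp (tendsto_add_atTop_nat 1)
  obtain ⟨N₀, hN₀⟩ := eventually_atTop.1 (ht.eventually_lt_const (inv_pos.2 hr0))
  refine ⟨N₀, fun N hN => ?_⟩
  have h := hN₀ N hN
  simp only [Function.comp] at h
  rw [div_lt_iff₀ (pow_pos hr0 _)] at h
  have e : r⁻¹ * r ^ (N + 1) = r ^ N := by
    rw [pow_succ]; field_simp
  rw [e] at h
  have e2 : r ^ N = (2 : ℝ) ^ (η * N) := by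
    rw [hr_def, ← Real.rpow_mul_natCast (by norm_num)]
  push_cast at h
  rw [e2] at h
  exact h.le

/-- **MERGE-OPTIMALITY ON THE LASER CLASS** — the route item `LaserClassMergeOptimal`: a single
product `⟨m,m,m⟩` through a laser datum of extent `N` has
`m² ≤ 2^{(ℓ(ω)+ε)N}`, `ℓ(ω) = 2/3 + (2/ω)(log₂3 − 2/3)` — literally the conclusion of the residual
`LaserMergeOptimal`, proved for every packing that factors through the laser class. -/
theorem laserClassMergeOptimal : ∀ ε : ℝ, 0 < ε → ∃ N₀ : ℕ, ∀ N : ℕ, N₀ ≤ N →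
    ∀ (p : ℕ) (x y z : Fin p → ℕ) (m : ℕ), (∀ i, x i + y i + z i = N) →
    (∀ t : ℕ × ℕ × ℕ, (Finset.univ.filter (fun j => (x j, y j, z j) = t)).card ≤
      N.choose (min t.1 (min t.2.1 t.2.2))) →
    TensorRestrictsTo (matMulDirectSum ℂ (fun i => 2 ^ x i) (fun i => 2 ^ y i) (fun i => 2 ^ z i))
      (matMulTensor ℂ m m m) →
    (m : ℝ) ^ 2 ≤ (2 : ℝ) ^ ((2 / 3 + 2 / omega ℂ * (Real.logb 2 3 - 2 / 3) + ε) * N) := by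
  intro ε hε
  obtain ⟨N₀, hN₀⟩ := eventually_poly_le 3 hε
  refine ⟨N₀, fun N hN p x y z m hsum hcap hD => ?_⟩
  have hω : 2 ≤ omega ℂ := omega_two_le ℂ
  obtain ⟨ω, hωdef⟩ : ∃ w : ℝ, w = omega ℂ := ⟨_, rfl⟩
  obtain ⟨G, hG, hτ⟩ := exists_top_point
  have hcapa := laserClassCapacity_point_one hG hsum hcap hD
  rw [hτ, ← hωdef] at hcapa
  rw [← hωdef] at hω ⊢
  have hpoly := hN₀ N hN
  rcases Nat.eq_zero_or_pos m with rfl | hm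
  · rw [Nat.cast_zero, zero_pow two_ne_zero]; positivity
  have hm0 : (0 : ℝ) < m := by exact_mod_cast hm
  have hlog2 : 0 < Real.log 2 := Real.log_pos one_lt_two
  have hL : Real.logb 2 3 * Real.log 2 = Real.log 3 := by
    rw [Real.logb, div_mul_cancel₀ _ hlog2.ne']
  have hω0 : 0 < ω := by linarith
  obtain ⟨u, hu⟩ : ∃ u : ℝ, u = 2 / ω := ⟨_, rfl⟩
  have hu0 : 0 < u := hu ▸ div_pos two_pos hω0
  have hu1 : u ≤ 1 := by rw [hu, div_le_one hω0]; exact hω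
  have huω : u * ω = 2 := by rw [hu]; field_simp
  have hP0 : (0 : ℝ) < ((N : ℝ) + 1) ^ 3 := by positivity
  -- (K) capacity in logarithms
  have hK : ω * Real.log m ≤ Real.log (((N : ℝ) + 1) ^ 3) + N * Real.log 3 +
      (ω - 2) / 3 * N * Real.log 2 := by
    have h := Real.log_le_log (Real.rpow_pos_of_pos hm0 ω) hcapa
    have h3N : Real.log ((3 : ℝ) ^ N) = (N : ℝ) * Real.log 3 := Real.log_pow _ _
    rw [Real.log_rpow hm0, Real.log_mul (by positivity) (by positivity),
      Real.log_mul (by positivity) (by positivity), h3N,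
      Real.log_rpow two_pos] at h
    exact h
  have hKu : 2 * Real.log m ≤ u * Real.log (((N : ℝ) + 1) ^ 3) + u * (N * Real.log 3) +
      2 / 3 * (N * Real.log 2) - 2 / 3 * u * (N * Real.log 2) := by
    have h := mul_le_mul_of_nonneg_left hK hu0.le
    have e1 : u * (ω * Real.log m) = 2 * Real.log m := by linear_combination Real.log m * huω
    have e2 : u * (Real.log (((N : ℝ) + 1) ^ 3) + N * Real.log 3 + (ω - 2) / 3 * N * Real.log 2) =
        u * Real.log (((N : ℝ) + 1) ^ 3) + u * (N * Real.log 3) + 2 / 3 * (N * Real.log 2) -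
          2 / 3 * u * (N * Real.log 2) := by
      linear_combination (1 / 3 * (N : ℝ) * Real.log 2) * huω
    linarith
  -- polynomial term
  have hPl : Real.log (((N : ℝ) + 1) ^ 3) ≤ ε * N * Real.log 2 := by
    have h := Real.log_le_log hP0 hpoly
    rwa [Real.log_rpow two_pos] at h
  have hPl0 : 0 ≤ Real.log (((N : ℝ) + 1) ^ 3) :=
    Real.log_nonneg (one_le_pow₀ (by linarith [(Nat.cast_nonneg N : (0 : ℝ) ≤ N)]))
  have hPu : u * Real.log (((N : ℝ) + 1) ^ 3) ≤ Real.log (((N : ℝ) + 1) ^ 3) :=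
    mul_le_of_le_one_left hPl0 hu1
  have rhs_eq : Real.log 2 * ((2 / 3 + 2 / ω * (Real.logb 2 3 - 2 / 3) + ε) * N) =
      2 / 3 * (N * Real.log 2) + u * (N * Real.log 3) - 2 / 3 * u * (N * Real.log 2) +
        ε * N * Real.log 2 := by
    rw [hu, ← hL]; ring
  have hgoal : 2 * Real.log m ≤ Real.log 2 * ((2 / 3 + 2 / ω * (Real.logb 2 3 - 2 / 3) + ε) * N) := by
    linarith
  have hm2 : ((m : ℝ)) ^ 2 = Real.exp (2 * Real.log m) := by
    rw [← Real.exp_log (pow_pos hm0 2), Real.log_pow]; norm_num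
  rw [hm2, Real.rpow_def_of_pos two_pos, Real.exp_le_exp]
  exact hgoal

/-- **NO CHEAP TANGENCY INSIDE THE LASER CLASS** — the route item `LaserClassTangencyForcesOmega`:
an `LT(s)` datum (cap `b < b_L`, packings beating the chord by the factor `3^{sN}·2^{(2/3)(1−s)N}`
cofinally) realised by packings THROUGH LASER DATA forces `ω ≤ 2/s`.  (Capacity at `ω` + cap:
`(s − 2/ω)·Γ·N ≤ εN + 3·log(N+1)` with `Γ = log 3 − (2/3 + b)·log 2 > 0`; pick `ε`, `N`.) -/
theorem laserClassTangencyForcesOmega : ∀ s : ℝ, 0 < s →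
    (∃ b : ℝ, b < Real.logb 2 3 - 2 / 3 ∧ ∀ ε : ℝ, 0 < ε → ∀ N₀ : ℕ, ∃ N : ℕ, N₀ ≤ N ∧
      ∃ (p : ℕ) (x y z : Fin p → ℕ) (B m : ℕ), (∀ i, x i + y i + z i = N) ∧
        (∀ t : ℕ × ℕ × ℕ, (Finset.univ.filter (fun j => (x j, y j, z j) = t)).card ≤
          N.choose (min t.1 (min t.2.1 t.2.2))) ∧
        TensorRestrictsTo
          (matMulDirectSum ℂ (fun i => 2 ^ x i) (fun i => 2 ^ y i) (fun i => 2 ^ z i))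
          (kroneckerTensor (unitTensor ℂ B) (matMulTensor ℂ m m m)) ∧
        (B : ℝ) ≤ (2 : ℝ) ^ (b * N) ∧
        (2 : ℝ) ^ ((2 / 3 * (1 - s) - ε) * N) * (3 : ℝ) ^ (s * N) ≤ (B : ℝ) ^ s * (m : ℝ) ^ 2) →
    omega ℂ ≤ 2 / s := by
  intro s hs0 hLT
  have hω : 2 ≤ omega ℂ := omega_two_le ℂ
  by_contra hne
  have hω2 : 2 / s < omega ℂ := lt_of_not_ge hne
  obtain ⟨ω, hωdef⟩ : ∃ w : ℝ, w = omega ℂ := ⟨_, rfl⟩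
  rw [← hωdef] at hω hω2
  have hlog2 : 0 < Real.log 2 := Real.log_pos one_lt_two
  have hlog2' : Real.log 2 ≤ 1 := by
    rw [Real.log_le_iff_le_exp (by norm_num)]; linarith [Real.add_one_le_exp (1 : ℝ)]
  have hL : Real.logb 2 3 * Real.log 2 = Real.log 3 := by
    rw [Real.logb, div_mul_cancel₀ _ hlog2.ne']
  have hω0 : 0 < ω := by linarith
  obtain ⟨u, hu⟩ : ∃ u : ℝ, u = 2 / ω := ⟨_, rfl⟩
  have hu0 : 0 < u := hu ▸ div_pos two_pos hω0
  have hu1 : u ≤ 1 := by rw [hu, div_le_one hω0]; exact hω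
  have huω : u * ω = 2 := by rw [hu]; field_simp
  have hsu : u < s := by
    rw [hu, div_lt_iff₀ hω0]
    have := (div_lt_iff₀ hs0).1 hω2
    linarith
  obtain ⟨b, hb, hP⟩ := hLT
  obtain ⟨Γ, hΓ⟩ : ∃ G : ℝ, G = Real.log 3 - 2 / 3 * Real.log 2 - b * Real.log 2 := ⟨_, rfl⟩
  have hΓ0 : 0 < Γ := by
    have h1 : 0 < (Real.logb 2 3 - 2 / 3 - b) * Real.log 2 := mul_pos (by linarith) hlog2
    have h2 : (Real.logb 2 3 - 2 / 3 - b) * Real.log 2 = Γ := by rw [hΓ, ← hL]; ring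
    linarith
  obtain ⟨M, hM⟩ : ∃ M : ℝ, M = (s - u) * Γ := ⟨_, rfl⟩
  have hM0 : 0 < M := by rw [hM]; exact mul_pos (by linarith) hΓ0
  obtain ⟨ε, hε⟩ : ∃ ε : ℝ, ε = M / 4 := ⟨_, rfl⟩
  have hε0 : 0 < ε := by rw [hε]; positivity
  obtain ⟨N₀, hN₀⟩ := eventually_poly_le 3 hε0
  obtain ⟨N, hN, p, x, y, z, B, m, hsum, hcap, hD, hcapB, hA⟩ := hP ε hε0 (max N₀ 1)
  have hNN₀ : N₀ ≤ N := (le_max_left _ _).trans hN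
  have hN1 : (1 : ℝ) ≤ N := by exact_mod_cast (le_max_right _ _).trans hN
  have hn0 : (0 : ℝ) ≤ N := Nat.cast_nonneg N
  -- `B ≥ 1`, `m ≥ 1`
  have lhs_pos : (0 : ℝ) < (2 : ℝ) ^ ((2 / 3 * (1 - s) - ε) * N) * (3 : ℝ) ^ (s * N) :=
    mul_pos (Real.rpow_pos_of_pos two_pos _) (Real.rpow_pos_of_pos (by norm_num) _)
  have hB1 : 1 ≤ B := by
    by_contra hB
    have hB' : B = 0 := by omega
    rw [hB', Nat.cast_zero, Real.zero_rpow hs0.ne', zero_mul] at hA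
    linarith
  have hB0 : (0 : ℝ) < B := by exact_mod_cast hB1
  have hm0 : (0 : ℝ) < m := by
    rcases Nat.eq_zero_or_pos m with h0 | h0
    · rw [h0, Nat.cast_zero] at hA
      have : (B : ℝ) ^ s * (0 : ℝ) ^ 2 = 0 := by simp
      linarith
    · exact_mod_cast h0
  -- capacity at ω
  have hcapa := laserClassCapacity N p x y z B m hsum hcap hD
  rw [← hωdef] at hcapa
  have hP0 : (0 : ℝ) < ((N : ℝ) + 1) ^ 3 := by positivity
  have hK : Real.log B + ω * Real.log m ≤ Real.log (((N : ℝ) + 1) ^ 3) + N * Real.log 3 +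
      (ω - 2) / 3 * N * Real.log 2 := by
    have h := Real.log_le_log (mul_pos hB0 (Real.rpow_pos_of_pos hm0 ω)) hcapa
    have h3N : Real.log ((3 : ℝ) ^ N) = (N : ℝ) * Real.log 3 := Real.log_pow _ _
    rw [Real.log_mul hB0.ne' (Real.rpow_pos_of_pos hm0 ω).ne', Real.log_rpow hm0,
      Real.log_mul (by positivity) (by positivity), Real.log_mul (by positivity) (by positivity),
      h3N, Real.log_rpow two_pos] at h
    exact h
  have hKu : u * Real.log B + 2 * Real.log m ≤ u * Real.log (((N : ℝ) + 1) ^ 3) +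
      u * (N * Real.log 3) + 2 / 3 * (N * Real.log 2) - 2 / 3 * u * (N * Real.log 2) := by
    have h := mul_le_mul_of_nonneg_left hK hu0.le
    have e1 : u * (Real.log B + ω * Real.log m) = u * Real.log B + 2 * Real.log m := by
      linear_combination Real.log m * huω
    have e2 : u * (Real.log (((N : ℝ) + 1) ^ 3) + N * Real.log 3 + (ω - 2) / 3 * N * Real.log 2) =
        u * Real.log (((N : ℝ) + 1) ^ 3) + u * (N * Real.log 3) + 2 / 3 * (N * Real.log 2) -
          2 / 3 * u * (N * Real.log 2) := by
      linear_combination (1 / 3 * (N : ℝ) * Real.log 2) * huω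
    linarith
  -- (A) the tangency inequality in logarithms
  have hAL : (2 / 3 * (1 - s) - ε) * N * Real.log 2 + s * N * Real.log 3 ≤
      s * Real.log B + 2 * Real.log m := by
    have := Real.log_le_log lhs_pos hA
    rw [Real.log_mul (Real.rpow_pos_of_pos two_pos _).ne' (Real.rpow_pos_of_pos (by norm_num) _).ne',
      Real.log_rpow two_pos, Real.log_rpow (by norm_num : (0 : ℝ) < 3),
      Real.log_mul (Real.rpow_pos_of_pos hB0 s).ne' (pow_pos hm0 2).ne', Real.log_rpow hB0,
      Real.log_pow] at this
    push_cast at this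
    linarith
  -- (C) the cap in logarithms, times `s − u > 0`
  have hcapL : Real.log B ≤ b * N * Real.log 2 := by
    have := Real.log_le_log hB0 hcapB
    rwa [Real.log_rpow two_pos] at this
  have hsuB : (s - u) * Real.log B ≤ (s - u) * (b * N * Real.log 2) :=
    mul_le_mul_of_nonneg_left hcapL (by linarith)
  -- polynomial term
  have hPl : Real.log (((N : ℝ) + 1) ^ 3) ≤ ε * N * Real.log 2 := by
    have h := Real.log_le_log hP0 (hN₀ N hNN₀)
    rwa [Real.log_rpow two_pos] at h
  have hPl0 : 0 ≤ Real.log (((N : ℝ) + 1) ^ 3) := Real.log_nonneg (one_le_pow₀ (by linarith))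
  have hPu : u * Real.log (((N : ℝ) + 1) ^ 3) ≤ Real.log (((N : ℝ) + 1) ^ 3) :=
    mul_le_of_le_one_left hPl0 hu1
  have hF4 : ε * N * Real.log 2 ≤ ε * N := by
    have := mul_le_mul_of_nonneg_left hlog2' (mul_nonneg hε0.le hn0)
    linarith
  have hMN : M * N = (s - u) * (N * Real.log 3) - 2 / 3 * (s - u) * (N * Real.log 2) -
      (s - u) * (b * N * Real.log 2) := by rw [hM, hΓ]; ring
  have hεn : ε * N = M / 4 * N := by rw [hε]
  have hMN1 : M ≤ M * N := le_mul_of_one_le_right hM0.le hN1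
  -- the contradiction
  linarith [hAL, hKu, hsuB, hPl, hPu, hF4, hMN, hεn, hMN1, hM0]

/-! ## 6. The laser class is inhabited at full strength (Coppersmith–Winograd's construction) -/

/-- `⟨q⟩ ⊗ ⟨a,b,c⟩` is the relabelling of the direct sum of `q` copies of `⟨a,b,c⟩` along
`Σ _ : Fin q, X ≃ Fin q × X`. -/
theorem unit_kronecker_matMul_eq (q a b c : ℕ) :
    kroneckerTensor (unitTensor ℂ q) (matMulTensor ℂ a b c) = fun u v w =>
      matMulDirectSum ℂ (fun _ : Fin q => a) (fun _ => b) (fun _ => c)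
        ((Equiv.sigmaEquivProd (Fin q) (Fin a × Fin c)).symm u)
        ((Equiv.sigmaEquivProd (Fin q) (Fin a × Fin b)).symm v)
        ((Equiv.sigmaEquivProd (Fin q) (Fin b × Fin c)).symm w) := by
  funext u v w
  simp only [kroneckerTensor_apply, unitTensor_apply, matMulTensor, matMulDirectSum,
    Equiv.sigmaEquivProd, Equiv.coe_fn_symm_mk, Fin.ext_iff]
  by_cases h1 : (u.1 : ℕ) = v.1 <;> by_cases h2 : (v.1 : ℕ) = w.1 <;>
    by_cases h3 : (u.2.1 : ℕ) = v.2.1 <;> by_cases h4 : (v.2.2 : ℕ) = w.2.1 <;>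
    by_cases h5 : (u.2.2 : ℕ) = w.2.2 <;> simp [h1, h2, h3, h4, h5]

/-- The direct sum of `q` copies of `⟨a,b,c⟩` restricts to `⟨q⟩ ⊗ ⟨a,b,c⟩` … -/
theorem matMulDirectSum_const_restrictsTo (q a b c : ℕ) :
    TensorRestrictsTo (matMulDirectSum ℂ (fun _ : Fin q => a) (fun _ => b) (fun _ => c))
      (kroneckerTensor (unitTensor ℂ q) (matMulTensor ℂ a b c)) := by
  rw [unit_kronecker_matMul_eq]
  exact tensorRestrictsTo_precomp _ _ _ _

/-- … and conversely. -/
theorem restrictsTo_matMulDirectSum_const (q a b c : ℕ) :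
    TensorRestrictsTo (kroneckerTensor (unitTensor ℂ q) (matMulTensor ℂ a b c))
      (matMulDirectSum ℂ (fun _ : Fin q => a) (fun _ => b) (fun _ => c)) := by
  rw [unit_kronecker_matMul_eq]
  exact tensorRestrictsTo_of_reindex _ _ _ _

/-- **THE LASER CLASS IS INHABITED AT FULL STRENGTH** — the route item `LaserClassAttained`:
Coppersmith–Winograd's laser zeroing of `cw₂^{⊠3k}` IS a laser datum (`min(p_k, C(3k,k))` blocks,
all of type `(k,k,k)`), it restricts to `⟨B⟩ ⊗ ⟨2^k,2^k,2^k⟩` with `B·4^k ≥ 27^{(1−ε)k}`; so the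
capacity bound `B·m^θ ≤ (N+1)³·3^N·2^{((θ−2)/3)N}` is attained up to `2^{−o(N)}` at EVERY exponent
`θ` (here `m = 2^{N/3}` exactly). [cite: BurgisserClausenShokrollahi1997, Thm. 15.41 (proof, p. 381)] -/
theorem laserClassAttained : ∀ ε : ℝ, 0 < ε → ∀ N₀ : ℕ, ∃ N : ℕ, N₀ ≤ N ∧
    ∃ (p : ℕ) (x y z : Fin p → ℕ) (B m : ℕ), (∀ i, x i + y i + z i = N) ∧
      (∀ t : ℕ × ℕ × ℕ, (Finset.univ.filter (fun j => (x j, y j, z j) = t)).card ≤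
        N.choose (min t.1 (min t.2.1 t.2.2))) ∧
      TensorRestrictsTo (kroneckerPow (cwTensor ℂ 2) N)
        (matMulDirectSum ℂ (fun i => 2 ^ x i) (fun i => 2 ^ y i) (fun i => 2 ^ z i)) ∧
      TensorRestrictsTo (matMulDirectSum ℂ (fun i => 2 ^ x i) (fun i => 2 ^ y i) (fun i => 2 ^ z i))
        (kroneckerTensor (unitTensor ℂ B) (matMulTensor ℂ m m m)) ∧
      (2 : ℝ) ^ ((N : ℝ) / 3) ≤ (m : ℝ) ∧ (3 : ℝ) ^ ((1 - ε) * N) ≤ (B : ℝ) * (m : ℝ) ^ 2 := by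
  intro ε hε N₀
  have hlog2 : 0 < Real.log 2 := Real.log_pos one_lt_two
  have hlog2' : Real.log 2 ≤ 1 := by
    rw [Real.log_le_iff_le_exp (by norm_num)]; linarith [Real.add_one_le_exp (1 : ℝ)]
  have hlog3 : 0 < Real.log 3 := Real.log_pos (by norm_num)
  obtain ⟨k₁, hk₁⟩ := exists_nat_forall_sqrt_le 12 (Real.log 96) (3 * ε * Real.log 3) (by positivity)
  obtain ⟨k₂, hk₂⟩ := eventually_poly_le 1 (η := ε * Real.log 3) (by positivity)
  obtain ⟨k, hk⟩ : ∃ k : ℕ, k = max (max k₁ k₂) (max N₀ 1) := ⟨_, rfl⟩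
  have hk1 : 1 ≤ k := by rw [hk]; omega
  have hkk₁ : k₁ ≤ k := by rw [hk]; omega
  have hkk₂ : k₂ ≤ 3 * k := by rw [hk]; omega
  have hkN₀ : N₀ ≤ 3 * k := by rw [hk]; omega
  have hk0 : (0 : ℝ) ≤ k := Nat.cast_nonneg k
  obtain ⟨p, hp0, hlogp, hres⟩ := laserBlocks k hk1
  obtain ⟨C, hCdef⟩ : ∃ C : ℕ, C = (3 * k).choose k := ⟨_, rfl⟩
  have hCpos : 0 < C := hCdef ▸ Nat.choose_pos (by omega)
  have hC0 : (0 : ℝ) < C := by exact_mod_cast hCpos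
  have hC : ((27 : ℝ) / 4) ^ k ≤ (3 * k + 1) * (C : ℝ) := hCdef ▸ pow_le_mul_choose_three_mul k
  refine ⟨3 * k, hkN₀, min p C, fun _ => k, fun _ => k, fun _ => k, min p C, 2 ^ k,
    fun _ => by ring, ?_, ?_, matMulDirectSum_const_restrictsTo _ _ _ _, ?_, ?_⟩
  · -- multiplicities: one type `(k,k,k)`, `min p C ≤ C = C(3k, k)` blocks
    intro t
    by_cases ht : ((k, k, k) : ℕ × ℕ × ℕ) = t
    · subst ht
      calc _ ≤ (Finset.univ : Finset (Fin (min p C))).card := Finset.card_filter_le _ _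
        _ = min p C := by simp
        _ ≤ C := min_le_right _ _
        _ = (3 * k).choose k := hCdef
        _ ≤ _ := by simp
    · simp [ht]
  · -- `cw₂^{⊠3k} ≥ ⟨p⟩ ⊗ T ≥ ⟨min p C⟩ ⊗ T ≥ ⊕ T`
    exact (hres.trans ((tensorRestrictsTo_unitTensor_castLE (min_le_left p C)).kronecker
      (TensorRestrictsTo.refl _))).trans (restrictsTo_matMulDirectSum_const _ _ _ _)
  · have e : (((3 * k : ℕ) : ℝ) / 3) = (k : ℝ) := by push_cast; ring
    rw [e, Real.rpow_natCast]; push_cast; exact le_rfl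
  · -- `27^{(1-ε)k} ≤ min(p, C) · 4^k`
    have h2k : (0 : ℝ) < ((2 ^ k : ℕ) : ℝ) := by positivity
    have h4k : (0 : ℝ) < (((2 ^ k : ℕ) : ℝ)) ^ 2 := pow_pos h2k 2
    have h3 : (0 : ℝ) < (3 : ℝ) ^ ((1 - ε) * ((3 * k : ℕ) : ℝ)) := Real.rpow_pos_of_pos (by norm_num) _
    have lhs : Real.log ((3 : ℝ) ^ ((1 - ε) * ((3 * k : ℕ) : ℝ))) = (1 - ε) * (3 * k) * Real.log 3 := by
      rw [Real.log_rpow (by norm_num)]; push_cast; ring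
    have h274 : Real.log (27 / 4) = 3 * Real.log 3 - 2 * Real.log 2 := by
      rw [show (27 : ℝ) / 4 = 3 ^ 3 / 2 ^ 2 by norm_num, Real.log_div (by norm_num) (by norm_num),
        Real.log_pow, Real.log_pow]; push_cast; ring
    have hlog4k : Real.log ((((2 ^ k : ℕ) : ℝ)) ^ 2) = 2 * k * Real.log 2 := by
      rw [Real.log_pow]; push_cast; rw [Real.log_pow]; ring
    -- the Behrend side: `log p ≥ 3k log 3 − 2k log 2 − 3εk log 3`
    have hthr₁ := hk₁ k hkk₁
    have hp : (3 : ℝ) ^ ((1 - ε) * ((3 * k : ℕ) : ℝ)) ≤ (p : ℝ) * (((2 ^ k : ℕ) : ℝ)) ^ 2 := by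
      rw [← Real.log_le_log_iff h3 (mul_pos hp0 h4k), lhs, Real.log_mul hp0.ne' h4k.ne', hlog4k]
      rw [h274] at hlogp
      nlinarith [hlogp, hthr₁, hlog3, hlog2, hε, mul_nonneg hk0 hlog3.le,
        mul_nonneg (mul_nonneg hε.le hk0) hlog3.le]
    -- the binomial side: `log C ≥ 3k log 3 − 2k log 2 − log(3k+1)`, `log(3k+1) ≤ 3εk log 3`
    have hCb : (3 : ℝ) ^ ((1 - ε) * ((3 * k : ℕ) : ℝ)) ≤ (C : ℝ) * (((2 ^ k : ℕ) : ℝ)) ^ 2 := by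
      have h31 : (0 : ℝ) < 3 * k + 1 := by positivity
      have hlogC : k * (3 * Real.log 3 - 2 * Real.log 2) ≤ Real.log (3 * k + 1) + Real.log C := by
        have := Real.log_le_log (pow_pos (by norm_num) k) hC
        rwa [Real.log_pow, h274, Real.log_mul h31.ne' hC0.ne'] at this
      have hpoly : Real.log (3 * (k : ℝ) + 1) ≤ 3 * ε * k * Real.log 3 := by
        have h := hk₂ (3 * k) hkk₂
        rw [pow_one] at h
        have h' := Real.log_le_log (by positivity) h
        rw [Real.log_rpow two_pos] at h'
        push_cast at h'
        have : ε * Real.log 3 * (3 * (k : ℝ)) * Real.log 2 ≤ ε * Real.log 3 * (3 * (k : ℝ)) := by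
          have := mul_le_mul_of_nonneg_left hlog2' (by positivity : (0 : ℝ) ≤ ε * Real.log 3 * (3 * k))
          linarith
        linarith
      rw [← Real.log_le_log_iff h3 (mul_pos hC0 h4k), lhs, Real.log_mul hC0.ne' h4k.ne', hlog4k]
      nlinarith [hlogC, hpoly]
    rw [Nat.cast_min, min_mul_of_nonneg _ _ h4k.le]
    exact le_min hp hCb

/-! ## 7. The route items hold -/

/-- The route item `LaserClassMergeOptimal` (stmt-MatrixMultiplication-33774) holds. -/
theorem laserClassMergeOptimal_holds :
    Summit.MatrixMultiplication.MatrixMultiplication.Theses.OutsiderSandwich.LaserClassMergeOptimal :=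
  laserClassMergeOptimal

/-- The route item `LaserClassTangencyForcesOmega` (stmt-MatrixMultiplication-33775) holds. -/
theorem laserClassTangencyForcesOmega_holds :
    Summit.MatrixMultiplication.MatrixMultiplication.Theses.OutsiderSandwich.LaserClassTangencyForcesOmega :=
  laserClassTangencyForcesOmega

/-- The route item `LaserClassAttained` (stmt-MatrixMultiplication-33776) holds. -/
theorem laserClassAttained_holds :
    Summit.MatrixMultiplication.MatrixMultiplication.Theses.OutsiderSandwich.LaserClassAttained :=
  laserClassAttained

end Summit.MatrixMultiplication.MatrixMultiplication.Theorems.OutsiderSandwichLaserClassRates
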